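import Mathlib
import Summits.Ventures.PercRepro2.Tail2DBlockCalc
import Summits.Ventures.PercRepro2.Tail2DHarrisSP
import Summits.Ventures.PercRepro2.Tail2DFlowOneBlocks
import Summits.Ventures.PercRepro2.Tail2DFlowOneStep01
import Summits.Ventures.PercRepro2.Tail2DParFin
import Summits.Ventures.PercRepro2.Tail2DParFinFlip
import Summits.Ventures.PercRepro2.Tail2DParFinTop
import Summits.Ventures.PercRepro2.Tail2DParFinDiag
import Summits.Ventures.PercRepro2.Tail2DSDomSwap
import Summits.Ventures.PercRepro2.Tail2DParFinCount
import Summits.Ventures.PercRepro2.Tail2DParFinRelax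
import Summits.Ventures.PercRepro2.Tail2DParFinSubTop

/-!
# (SD) at the sub-top level `u + v = k − 1` on `k` flow-one factors: the one-change certificate, part II
(seat mine-b, cell pub-perc-repro2; conjectures/MINE-B.md §44)

Words updated by `R` at one position and their letter counts, the sizes of the `col` blocks, and the SOURCE coverage of
the certificate of part I: a bottom word spends its mass on the uniform flips of its reds, a common word on the
identity, the flips and the relaxes (`ι + Σ_i f(w,i) + ξ Σ_i (1 + γ_i) = 1`, `sum_stRate`), so the weighted source
blocks reproduce the uniform measure on `E(u,v)` (`st_src_cov`).
-/

namespace Summit.Ventures.PercRepro2.Tail2D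

open V2Closure Finset

section Words

variable (k : ℕ)

/-- `unflip w {i}` is the update of `w` at `i` by `R` -/
theorem unflip_singleton (w : Fin k → Ltr) (i : Fin k) : unflip k w {i} = Function.update w i Ltr.R := by
  ext j
  simp only [unflip, Finset.mem_singleton, Function.update_apply]

/-- `flipSet w {i}` is the update of `w` at `i` by `B` -/
theorem flipSet_singleton (w : Fin k → Ltr) (i : Fin k) : flipSet k w {i} = Function.update w i Ltr.B := by
  ext j
  simp only [flipSet, Finset.mem_singleton, Function.update_apply]

/-- the reds of the word updated by `R` at a non-red position -/
theorem redSet_update_R (w : Fin k → Ltr) (i : Fin k) (hi : w i ≠ Ltr.R) :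
    redSet k (Function.update w i Ltr.R) = insert i (redSet k w) := by
  ext j
  simp only [redSet, Finset.mem_filter, Finset.mem_univ, true_and, Finset.mem_insert, Function.update_apply]
  by_cases hj : j = i
  · subst hj; simp
  · simp [hj]

/-- `#R` of the word updated by `R` at a non-red position -/
theorem nR_update_R (w : Fin k → Ltr) (i : Fin k) (hi : w i ≠ Ltr.R) :
    nR k (Function.update w i Ltr.R) = nR k w + 1 := by
  rw [nR_eq_card_redSet, nR_eq_card_redSet, redSet_update_R k w i hi, Finset.card_insert_of_notMem]
  simp [redSet, hi]

/-- `#B` of the word updated by `R` at a non-blue position -/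
theorem nB_update_R_of_ne (w : Fin k → Ltr) (i : Fin k) (hi : w i ≠ Ltr.B) :
    nB k (Function.update w i Ltr.R) = nB k w := by
  rw [nB_eq_card_blueSet, nB_eq_card_blueSet]
  congr 1
  ext j
  simp only [blueSet, Finset.mem_filter, Finset.mem_univ, true_and, Function.update_apply]
  by_cases hj : j = i
  · subst hj; simp [hi]
  · simp [hj]

/-- `#B` of the word updated by `R` at a blue position -/
theorem nB_update_R_of_B (w : Fin k → Ltr) (i : Fin k) (hi : w i = Ltr.B) :
    nB k (Function.update w i Ltr.R) + 1 = nB k w := by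
  rw [← unflip_singleton]
  exact nB_unflip k w {i} (by intro j hj; rw [Finset.mem_singleton] at hj; subst hj; simp [blueSet, hi])

/-- the reds and blues of a word without `C` cover everything -/
theorem redSet_union_blueSet (w : Fin k → Ltr) (hw : ∀ i, w i ≠ Ltr.C) :
    redSet k w ∪ blueSet k w = Finset.univ := by
  ext j
  simp only [redSet, blueSet, Finset.mem_union, Finset.mem_filter, Finset.mem_univ, true_and, iff_true]
  cases hj : w j
  · left; rfl
  · right; rfl
  · exact absurd hj (hw j)

/-- the reds and blues of a word are disjoint -/
theorem disjoint_redSet_blueSet (w : Fin k → Ltr) : Disjoint (redSet k w) (blueSet k w) := by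
  rw [Finset.disjoint_left]
  intro j h1 h2
  simp only [redSet, blueSet, Finset.mem_filter, Finset.mem_univ, true_and] at h1 h2
  rw [h1] at h2
  exact Ltr.noConfusion h2

end Words

section Sums

variable (k : ℕ) (X : Fin k → V2Closure.SP) (u v : ℕ)

/-- `Γ_ρ` of the word updated by `R` at a non-red position -/
theorem gamRed_update_R (w : Fin k → Ltr) (i : Fin k) (hi : w i ≠ Ltr.R) :
    gamRed k X (Function.update w i Ltr.R) = gamRed k X w + gam k X i := by
  unfold gamRed
  rw [redSet_update_R k w i hi, Finset.sum_insert (by simp [redSet, hi]), add_comm]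

/-- for a word without `C`: `Γ_ρ(w) + Σ_{i blue} γ_i = Γ` -/
theorem gamRed_add_blue (w : Fin k → Ltr) (hw : ∀ i, w i ≠ Ltr.C) :
    gamRed k X w + ∑ i ∈ blueSet k w, gam k X i = ∑ i, gam k X i := by
  unfold gamRed
  rw [← Finset.sum_union (disjoint_redSet_blueSet k w), redSet_union_blueSet k w hw]

/-- the size of the block of `w[i := C]` for `w i = R`: `|w| · γ_i` -/
theorem card_blockOf_update_C (hR : ∀ i, 0 < (rSet (X i)).card) (w : Fin k → Ltr) (i : Fin k) (hi : w i = Ltr.R) :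
    ((blockOf k X (Function.update w i Ltr.C)).card : ℚ) = (blockOf k X w).card * gam k X i := by
  rw [card_blockOf, card_blockOf]
  push_cast
  have e1 : (fun j => ((letterSet (X j) (Function.update w i Ltr.C j)).card : ℚ))
      = Function.update (fun j => ((letterSet (X j) (w j)).card : ℚ)) i ((cellSet (X i)).card : ℚ) := by
    ext j
    by_cases hj : j = i
    · subst hj; simp [letterSet]
    · simp [Function.update_of_ne hj]
  rw [e1, Finset.prod_update_of_mem (Finset.mem_univ i), Finset.sdiff_singleton_eq_erase,
    ← Finset.mul_prod_erase Finset.univ _ (Finset.mem_univ i)]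
  rw [hi]
  unfold gam
  have ha : ((rSet (X i)).card : ℚ) ≠ 0 := by exact_mod_cast (hR i).ne'
  show ((cellSet (X i)).card : ℚ) * ∏ x ∈ Finset.univ.erase i, ((letterSet (X x) (w x)).card : ℚ)
    = ((rSet (X i)).card : ℚ) * (∏ x ∈ Finset.univ.erase i, ((letterSet (X x) (w x)).card : ℚ))
      * (((cellSet (X i)).card : ℚ) / ((rSet (X i)).card : ℚ))
  field_simp

/-- the size of a `col` block at a red position: `|w| (1 + γ_i)` -/
theorem card_blockCol_eq (hX : ∀ i, FlowOne (X i)) (hR : ∀ i, 0 < (rSet (X i)).card) (w : Fin k → Ltr) (i : Fin k)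
    (hi : w i = Ltr.R) : ((blockCol k X w i).card : ℚ) = (blockOf k X w).card * (1 + gam k X i) := by
  rw [card_blockCol k X hX]
  push_cast
  rw [card_blockOf_update_C k X hR w i hi, ← flipSet_singleton, card_blockOf_flipSet k X w {i} (by
    intro j hj; rw [Finset.mem_singleton] at hj; subst hj; simp [redSet, hi])]
  ring

end Sums


section SourceCoverage

variable (k : ℕ) (X : Fin k → V2Closure.SP) (u v : ℕ)

/-- the rate of an index (per configuration of its source word) -/
noncomputable def stRate (w : Fin k → Ltr) (i : Fin k) (m : Fin 3) : ℚ :=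
  if stId k u v w i m then iotaQ k X u v / k
  else if stFl k u v w i m then (if stBot k u v w then ((nR k w : ℚ))⁻¹ else flQ k X u v w i)
  else if stRx k u v w i m then xiQ k X u v * (1 + gam k X i) else 0

/-- the weight is the rate times `|w|/|E|` -/
theorem stW_eq (hX : ∀ i, FlowOne (X i)) (hR : ∀ i, 0 < (rSet (X i)).card) (w : Fin k → Ltr) (i : Fin k) (m : Fin 3) :
    stW k X u v w i m = stRate k X u v w i m * (blockOf k X w).card / tailCount (parFin k X) u v := by
  unfold stW stRate
  by_cases h1 : stId k u v w i m
  · rw [if_pos h1, if_pos h1]; ring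
  · rw [if_neg h1, if_neg h1]
    by_cases h2 : stFl k u v w i m
    · rw [if_pos h2, if_pos h2]
    · rw [if_neg h2, if_neg h2]
      by_cases h3 : stRx k u v w i m
      · rw [if_pos h3, if_pos h3, card_blockCol_eq k X hX hR w i h3.2.2]; ring
      · rw [if_neg h3, if_neg h3]; ring

/-- the rate of an invalid index vanishes -/
theorem stRate_eq_zero (w : Fin k → Ltr) (i : Fin k) (m : Fin 3)
    (h : ¬ (stId k u v w i m ∨ stFl k u v w i m ∨ stRx k u v w i m)) : stRate k X u v w i m = 0 := by
  unfold stRate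
  rw [if_neg (fun h1 => h (Or.inl h1)), if_neg (fun h2 => h (Or.inr (Or.inl h2))),
    if_neg (fun h3 => h (Or.inr (Or.inr h3)))]

/-- the source term of an index at a configuration -/
theorem st_src_term (hX : ∀ i, FlowOne (X i)) (hR : ∀ i, 0 < (rSet (X i)).card) (w : Fin k → Ltr) (i : Fin k)
    (m : Fin 3) (z : (parFin k X).Conf) :
    stW k X u v w i m * unifDens (parFin k X) (stP k X u v w i m) z
      = if wordOf k X z = w then stRate k X u v w i m / tailCount (parFin k X) u v else 0 := by
  rw [stW_eq k X u v hX hR]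
  unfold stP
  by_cases hv : stId k u v w i m ∨ stFl k u v w i m ∨ stRx k u v w i m
  · rw [if_pos hv, unifDens_blockOf k X hX]
    by_cases h' : wordOf k X z = w
    · rw [if_pos h', if_pos h']
      have hpos : (0 : ℚ) < (blockOf k X w).card := by
        rw [← h']; exact_mod_cast card_blockOf_wordOf_pos k X hX z
      field_simp
    · rw [if_neg h', if_neg h', mul_zero]
  · rw [if_neg hv, unifDens_empty, stRate_eq_zero k X u v w i m hv]
    simp

/-- the three slices of the rate at a fixed position: `m = 0` -/
theorem stRate_zero (w : Fin k → Ltr) (i : Fin k) :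
    stRate k X u v w i 0 = if stCom k u v w then iotaQ k X u v / k else 0 := by
  unfold stRate
  have h1 : ¬ ((0 : Fin 3) = 1) := by decide
  have h2 : ¬ ((0 : Fin 3) = 2) := by decide
  by_cases h : stCom k u v w
  · rw [if_pos ⟨rfl, h⟩, if_pos h]
  · rw [if_neg (fun hh => h hh.2), if_neg (fun hh => h1 hh.1), if_neg (fun hh => h2 hh.1), if_neg h]

/-- `m = 1` -/
theorem stRate_one (w : Fin k → Ltr) (i : Fin k) :
    stRate k X u v w i 1 = if stSrc k u v w ∧ w i = Ltr.R
      then (if stBot k u v w then ((nR k w : ℚ))⁻¹ else flQ k X u v w i) else 0 := by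
  unfold stRate
  have h0 : ¬ ((1 : Fin 3) = 0) := by decide
  have h2 : ¬ ((1 : Fin 3) = 2) := by decide
  rw [if_neg (fun hh => h0 hh.1)]
  by_cases h : stSrc k u v w ∧ w i = Ltr.R
  · rw [if_pos ⟨rfl, h.1, h.2⟩, if_pos h]
  · rw [if_neg (fun hh => h ⟨hh.2.1, hh.2.2⟩), if_neg (fun hh => h2 hh.1), if_neg h]

/-- `m = 2` -/
theorem stRate_two (w : Fin k → Ltr) (i : Fin k) :
    stRate k X u v w i 2 = if stCom k u v w ∧ w i = Ltr.R then xiQ k X u v * (1 + gam k X i) else 0 := by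
  unfold stRate
  have h0 : ¬ ((2 : Fin 3) = 0) := by decide
  have h1 : ¬ ((2 : Fin 3) = 1) := by decide
  rw [if_neg (fun hh => h0 hh.1), if_neg (fun hh => h1 hh.1)]
  by_cases h : stCom k u v w ∧ w i = Ltr.R
  · rw [if_pos ⟨rfl, h.1, h.2⟩, if_pos h]
  · rw [if_neg (fun hh => h ⟨hh.2.1, hh.2.2⟩), if_neg h]

/-- a bottom word is not common -/
theorem stBot_not_com (w : Fin k → Ltr) (h : stBot k u v w) : ¬ stCom k u v w := fun h' => by
  have := h.2; have := h'.2; omega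

/-- a source word at the sub-top level is a bottom or a common word -/
theorem stSrc_cases (hk : u + v + 1 = k) (w : Fin k → Ltr) (h : stSrc k u v w) :
    stBot k u v w ∨ stCom k u v w := by
  have h3 := nR_add_nB_add_nC k w
  have := h.1; have := h.2
  by_cases hb : nB k w = v
  · exact Or.inl ⟨h, hb⟩
  · exact Or.inr ⟨h, by omega⟩

/-- **the rates of a source word sum to one** -/
theorem sum_stRate (hk : u + v + 1 = k) (huv : v + 2 ≤ u) (w : Fin k → Ltr) :
    ∑ i, ∑ m, stRate k X u v w i m = if stSrc k u v w then 1 else 0 := by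
  simp only [Fin.sum_univ_three, stRate_zero, stRate_one, stRate_two, Finset.sum_add_distrib]
  have hkpos : (0 : ℚ) < k := by exact_mod_cast (show 0 < k by omega)
  have hupos : (0 : ℚ) < u := by exact_mod_cast (show 0 < u by omega)
  by_cases hs : stSrc k u v w
  · rw [if_pos hs]
    rcases stSrc_cases k u v hk w hs with hb | hc
    · -- a bottom word: the uniform flips
      have hnc := stBot_not_com k u v w hb
      rw [Finset.sum_eq_zero (fun i _ => if_neg (show ¬ stCom k u v w from hnc)),
        Finset.sum_eq_zero (fun i _ => if_neg (show ¬ (stCom k u v w ∧ w i = Ltr.R) from fun h => hnc h.1)),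
        zero_add, add_zero]
      have e : ∀ i, (if stSrc k u v w ∧ w i = Ltr.R then (if stBot k u v w then ((nR k w : ℚ))⁻¹ else flQ k X u v w i) else 0)
          = if w i = Ltr.R then ((nR k w : ℚ))⁻¹ else 0 := by
        intro i
        by_cases hi : w i = Ltr.R
        · rw [if_pos ⟨hs, hi⟩, if_pos hb, if_pos hi]
        · rw [if_neg (fun h => hi h.2), if_neg hi]
      simp only [e]
      rw [← Finset.sum_filter]
      have hr : (Finset.univ.filter (fun i => w i = Ltr.R)) = redSet k w := rfl
      rw [hr, Finset.sum_const, ← nR_eq_card_redSet, nsmul_eq_mul]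
      have hn : (0 : ℚ) < nR k w := by exact_mod_cast (show 0 < nR k w by have := hs.1; omega)
      field_simp
    · -- a common word: identity, flips and relaxes
      have hnb : ¬ stBot k u v w := fun hb => stBot_not_com k u v w hb hc
      have hnR := stCom_nR hk w hc
      rw [Finset.sum_congr rfl (fun i _ => if_pos hc), Finset.sum_const, Finset.card_univ, Fintype.card_fin,
        nsmul_eq_mul]
      have e1 : ∀ i, (if stSrc k u v w ∧ w i = Ltr.R then (if stBot k u v w then ((nR k w : ℚ))⁻¹ else flQ k X u v w i) else 0)
          = if w i = Ltr.R then flQ k X u v w i else 0 := by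
        intro i
        by_cases hi : w i = Ltr.R
        · rw [if_pos ⟨hs, hi⟩, if_neg hnb, if_pos hi]
        · rw [if_neg (fun h => hi h.2), if_neg hi]
      have e2 : ∀ i, (if stCom k u v w ∧ w i = Ltr.R then xiQ k X u v * (1 + gam k X i) else 0)
          = if w i = Ltr.R then xiQ k X u v * (1 + gam k X i) else 0 := by
        intro i
        by_cases hi : w i = Ltr.R
        · rw [if_pos ⟨hc, hi⟩, if_pos hi]
        · rw [if_neg (fun h => hi h.2), if_neg hi]
      simp only [e1, e2]
      rw [← Finset.sum_filter, ← Finset.sum_filter]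
      have hr : (Finset.univ.filter (fun i => w i = Ltr.R)) = redSet k w := rfl
      rw [hr]
      have hsum1 : ∑ i ∈ redSet k w, flQ k X u v w i
          = (u : ℚ) * ((1 - iotaQ k X u v) / u - xiQ k X u v - xiQ k X u v / k * gamRed k X w)
            - xiQ k X u v / k * (v + 1) * gamRed k X w := by
        have e : ∀ i ∈ redSet k w, flQ k X u v w i
            = ((1 - iotaQ k X u v) / u - xiQ k X u v - xiQ k X u v / k * gamRed k X w)
              - (xiQ k X u v / k * (v + 1)) * gam k X i := by
          intro i _; unfold flQ; ring
        rw [Finset.sum_congr rfl e, Finset.sum_sub_distrib, Finset.sum_const, ← Finset.mul_sum,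
          ← nR_eq_card_redSet, hnR, nsmul_eq_mul]
        rfl
      have hsum2 : ∑ i ∈ redSet k w, xiQ k X u v * (1 + gam k X i) = xiQ k X u v * (u + gamRed k X w) := by
        rw [← Finset.mul_sum, Finset.sum_add_distrib, Finset.sum_const, ← nR_eq_card_redSet, hnR, nsmul_eq_mul,
          mul_one]
        rfl
      rw [hsum1, hsum2]
      have hk' : (k : ℚ) = u + v + 1 := by rw [← hk]; push_cast; ring
      rw [hk']
      field_simp
      ring
  · rw [if_neg hs]
    have e0 : (if stCom k u v w then iotaQ k X u v / k else 0) = 0 := if_neg (fun h => hs h.1)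
    have e1 : ∀ i, (if stSrc k u v w ∧ w i = Ltr.R then (if stBot k u v w then ((nR k w : ℚ))⁻¹ else flQ k X u v w i) else 0) = 0 :=
      fun i => if_neg (fun h => hs h.1)
    have e2 : ∀ i, (if stCom k u v w ∧ w i = Ltr.R then xiQ k X u v * (1 + gam k X i) else 0) = 0 :=
      fun i => if_neg (fun h => hs h.1.1)
    simp only [e0, e1, e2, Finset.sum_const_zero, add_zero]

/-- **the source coverage of the sub-top certificate** -/
theorem st_src_cov (hX : ∀ i, FlowOne (X i)) (hR : ∀ i, 0 < (rSet (X i)).card) (hk : u + v + 1 = k)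
    (huv : v + 2 ≤ u) (z : (parFin k X).Conf) :
    ∑ p : (Fin k → Ltr) × Fin k × Fin 3,
      stW k X u v p.1 p.2.1 p.2.2 * unifDens (parFin k X) (stP k X u v p.1 p.2.1 p.2.2) z
      = unifDens (parFin k X) (tailSet (parFin k X) u v) z := by
  set w0 := wordOf k X z with hw0
  set E : ℚ := (tailCount (parFin k X) u v : ℚ) with hE
  have hRHS : unifDens (parFin k X) (tailSet (parFin k X) u v) z = if stSrc k u v w0 then E⁻¹ else 0 := by
    unfold unifDens
    rw [hE, tailCount_eq_card]
    by_cases h : z ∈ tailSet (parFin k X) u v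
    · rw [if_pos h, if_pos ((mem_tailSet_parFin k X hX u v z).1 h)]
    · rw [if_neg h, if_neg (fun hh => h ((mem_tailSet_parFin k X hX u v z).2 hh))]
  rw [hRHS, Fintype.sum_prod_type]
  simp only [st_src_term k X u v hX hR]
  rw [Finset.sum_eq_single w0]
  · rw [Fintype.sum_prod_type]
    simp only [← hw0, if_true, ← Finset.sum_div, sum_stRate k X u v hk huv]
    by_cases hs : stSrc k u v w0
    · rw [if_pos hs, if_pos hs, one_div]
    · rw [if_neg hs, if_neg hs, zero_div]
  · intro w _ hw
    apply Finset.sum_eq_zero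
    intro p _
    rw [if_neg (fun h => hw h.symm)]
  · intro h; exact absurd (Finset.mem_univ _) h

end SourceCoverage

end Summit.Ventures.PercRepro2.Tail2D
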